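import Literature.NumberTheory.EllipticCurves.KugaSatoSchollProjectorEigen
import Literature.AlgebraicGeometry.Motives.BettiRealization
import HarnessLib

/-!
# Scholl's projector on the Betti cohomology of a Kuga–Sato variety

Topic: `Literature/NumberTheory/EllipticCurves`. For a Kuga–Sato variety `V : KugaSatoVariety K m N`
over a subfield `K ⊆ ℂ` (`[Algebra K ℂ]`), the group `Aut W` acts on the Betti cohomology
`Hⁱ_B(W) = Hⁱ(W(ℂ); ℚ)` (`Literature.AlgebraicGeometry.Motives.bettiCohomology`) by pull-back, and
Scholl's projector `Π_ε ∈ ℚ[Aut W]` (`KugaSatoSchollProjector.lean`; Deninger–Scholl 5.3 (i))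
therefore acts as an idempotent endomorphism of `Hⁱ_B(W)`; its image is the piece of `Hⁱ_B(W)`
on which the translations by `N`-torsion sections act trivially, the inversions by `-1` and the
permutations of the factors through the sign — the piece which, for `i = m + 1` and Deligne's
model `W = X̄̄_nᵐ`, "is the parabolic cohomology" `H¹(M̄_n, φ_* Symᵐ R¹π_*ℚ)`
(Deninger–Scholl 5.3 (i), 5.2 Remark (2); Scholl 1990, §1 — that identification is NOT
made here).

* `KugaSatoVariety.autBettiRep V i : Aut W →* End_ℚ Hⁱ_B(W)`, `g ↦ (g⁻¹)*` (pull-back along the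
  inverse, so that a HOMOMORPHISM is obtained from the contravariant `bettiCohomology.map`);
  `bettiAction V i : ℚ[Aut W] →ₐ[ℚ] End_ℚ Hⁱ_B(W)` its linear extension (Mathlib
  `MonoidAlgebra.lift`), `map_hom_eq_bettiAction` (`g* = bettiAction [g⁻¹]`);
* `schollProjectorBetti V i = bettiAction Π_ε`, an idempotent (`isIdempotentElem_…`,
  `schollProjectorBetti_comp_self`), and `schollPart V i = range (schollProjectorBetti V i)`;
* the action of the generators on `schollPart`: `(translW j u)* x = x`, `(negW j)* x = -x`,
  `(permW σ)* x = sgn(σ) x` (`map_translW_of_mem_schollPart`, `map_negW_of_mem_schollPart`,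
  `map_permW_of_mem_schollPart`), from the absorption relations of
  `KugaSatoSchollProjectorEigen.lean`.

Universe: Betti cohomology lives over `K : Type` (`ComplexPoints`), so this file is stated for
`KugaSatoVariety.{0}`. Hypothesis `[IsCommMonObj V.curve.E]` as in `KugaSatoSchollProjector.lean`;
no named facts; nothing here uses Hodge theory (the Hodge structure on `Hⁱ_B` is the hypothesis
structure `Motives.BettiHodgeData` elsewhere in the tree).

## References

* C. Deninger, A. J. Scholl, *The Beilinson conjectures*, in *L-functions and Arithmetic*,
  LMS LNS 153 (1991), 5.2 Remark (2), 5.3 (i). [DeningerScholl1991]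
* A. J. Scholl, *Motives for modular forms*, Invent. Math. 100 (1990), §1. [Scholl1990]
-/

open CategoryTheory Limits AlgebraicGeometry MonoidalCategory CartesianMonoidalCategory
open scoped MonObj

noncomputable section

namespace Literature.NumberTheory.EllipticCurves

/-! ### Modules over `ℚ[M]`: the image of an averaging idempotent is a joint eigenspace -/

section CharacterProjector

variable {G M : Type*} [Group G] [Fintype G] [Monoid M] {H : Type*} [AddCommGroup H] [Module ℚ H]
  (φ : MonoidAlgebra ℚ M →ₐ[ℚ] Module.End ℚ H) (ρ : G →* M) (χ : G →* ℚ)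

/-- On the image of `e_χ = |G|⁻¹ ∑ χ(g) [ρ g]` the group acts through `χ`:
`[ρ g] (e_χ x) = χ(g⁻¹) e_χ x` (left absorption). [folklore] -/
theorem apply_of_characterProjector_apply (g : G) (x : H) :
    φ (MonoidAlgebra.of ℚ M (ρ g)) (φ (characterProjector ρ χ) x) =
      χ g⁻¹ • φ (characterProjector ρ χ) x := by
  rw [← Module.End.mul_apply, ← map_mul, of_mul_characterProjector_eq_smul, map_smul,
    LinearMap.smul_apply]

/-- Conversely, a vector on which `ρ(G)` acts through `χ` is fixed by `e_χ`:
`(∀ g, [ρ g] x = χ(g⁻¹) x) → e_χ x = x`. [folklore] -/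
theorem characterProjector_apply_eq_self {x : H}
    (hx : ∀ g : G, φ (MonoidAlgebra.of ℚ M (ρ g)) x = χ g⁻¹ • x) :
    φ (characterProjector ρ χ) x = x := by
  have hG : (Fintype.card G : ℚ) ≠ 0 := Nat.cast_ne_zero.mpr Fintype.card_ne_zero
  rw [characterProjector, map_smul, map_sum, LinearMap.smul_apply, LinearMap.sum_apply]
  simp_rw [map_smul, LinearMap.smul_apply, hx, smul_smul, ← map_mul χ, mul_inv_cancel, map_one,
    one_smul]
  rw [Finset.sum_const, Finset.card_univ, ← Nat.cast_smul_eq_nsmul ℚ, smul_smul,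
    inv_mul_cancel₀ hG, one_smul]

end CharacterProjector

/-- In `(ℤ/2)^m` every element is its own inverse. [folklore] -/
theorem negPi_inv_eq_self {m : ℕ} (s : Fin m → Multiplicative (ZMod 2)) : s⁻¹ = s :=
  funext fun j => Multiplicative.toAdd.injective (by
    rw [Pi.inv_apply, toAdd_inv, ZMod.neg_eq_self_mod_two])

namespace KugaSatoVariety

section Complements

variable {K : Type*} [Field K] {m N : ℕ} (V : KugaSatoVariety K m N)

/-- `translW j (-u) = (translW j u)⁻¹` in `Aut W` (commutative universal curve). [folklore] -/
theorem translA_neg_eq_inv [NeZero N] [IsCommMonObj V.curve.E] (j : Fin m)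
    (u : ZMod N × ZMod N) : V.translA j (-u) = (V.translA j u)⁻¹ := by
  simpa only [translHom_apply, toAdd_inv, toAdd_ofAdd] using
    map_inv (V.translHom j) (Multiplicative.ofAdd u)

/-- Every translation `t ∈ ((ℤ/N)²)^m` (not only the generators) is absorbed: `[t] Π_ε = Π_ε`.
[cite: DeningerScholl1991, 5.3 (i)] -/
theorem of_translPiHom_mul_schollProjector [NeZero N] [IsCommMonObj V.curve.E]
    (t : Fin m → Multiplicative (ZMod N × ZMod N)) :
    MonoidAlgebra.of ℚ _ (V.translPiHom t) * V.schollProjector = V.schollProjector := by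
  rw [schollProjector, ← mul_assoc, ← mul_assoc, translProjector, of_mul_characterProjector_one]

/-- Every `s ∈ (ℤ/2)^m` acts on `Π_ε` through the product character: `[s] Π_ε = (∏ᵢ (-1)^{sᵢ}) Π_ε`.
[cite: DeningerScholl1991, 5.3 (i)] -/
theorem of_negPiHom_mul_schollProjector [NeZero N] [IsCommMonObj V.curve.E]
    (s : Fin m → Multiplicative (ZMod 2)) :
    MonoidAlgebra.of ℚ _ (V.negPiHom s) * V.schollProjector = negPiSign m s • V.schollProjector := by
  rw [schollProjector, ← mul_assoc, ← mul_assoc, ← (V.commute_translProjector_of_negPiHom s).eq,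
    mul_assoc V.translProjector, negProjector, of_mul_characterProjector_eq_smul, negPi_inv_eq_self,
    mul_smul_comm, smul_mul_assoc]

end Complements

open Literature.AlgebraicGeometry.Motives

variable {K : Type} [Field K] [Algebra K ℂ] {m N : ℕ} (V : KugaSatoVariety K m N)

/-! ### The action of `Aut W` and of `ℚ[Aut W]` on Betti cohomology -/

/-- **`Aut W` acts on `Hⁱ_B(W)`**: `g ↦ (g⁻¹)* = (g.inv)*`. Pull-back is contravariant
(`bettiCohomology.map_comp`) and `Aut W` multiplies by `e * f = f ≪≫ e`, so pulling back along
the inverse gives a homomorphism into `End_ℚ Hⁱ_B(W)` (whose product is composition).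
[folklore] -/
def autBettiRep (i : ℕ) : Aut V.W →* Module.End ℚ (bettiCohomology V.W i) where
  toFun g := (bettiCohomology.map g.inv i).hom
  map_one' := by
    show (bettiCohomology.map (𝟙 V.W) i).hom = 1
    rw [bettiCohomology.map_id]
    rfl
  map_mul' e f := by
    show (bettiCohomology.map (e.inv ≫ f.inv) i).hom =
      (bettiCohomology.map e.inv i).hom * (bettiCohomology.map f.inv i).hom
    rw [bettiCohomology.map_comp]
    rfl

/-- Unfolding of `autBettiRep`. [folklore] -/
@[simp]
theorem autBettiRep_apply (i : ℕ) (g : Aut V.W) :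
    V.autBettiRep i g = (bettiCohomology.map g.inv i).hom := rfl

/-- **The action of the group algebra `ℚ[Aut W]` on `Hⁱ_B(W)`**, the `ℚ`-linear extension of
`autBettiRep` (Mathlib `MonoidAlgebra.lift`). [folklore] -/
def bettiAction (i : ℕ) : MonoidAlgebra ℚ (Aut V.W) →ₐ[ℚ] Module.End ℚ (bettiCohomology V.W i) :=
  MonoidAlgebra.lift ℚ (Module.End ℚ (bettiCohomology V.W i)) (Aut V.W) (V.autBettiRep i)

/-- `bettiAction [g] = (g⁻¹)*`. [folklore] -/
@[simp]
theorem bettiAction_of (i : ℕ) (g : Aut V.W) :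
    V.bettiAction i (MonoidAlgebra.of ℚ _ g) = (bettiCohomology.map g.inv i).hom :=
  MonoidAlgebra.lift_of _ _

/-- Pull-back along an automorphism in terms of the action: `g* = bettiAction [g⁻¹]`. [folklore] -/
theorem map_hom_eq_bettiAction (i : ℕ) (g : Aut V.W) :
    (bettiCohomology.map g.hom i).hom = V.bettiAction i (MonoidAlgebra.of ℚ _ g⁻¹) := by
  rw [bettiAction_of]
  rfl

/-! ### Scholl's projector on `Hⁱ_B(W)` -/

/-- **Scholl's projector `Π_ε` acting on `Hⁱ_B(W)`** (Deninger–Scholl 5.3 (i): `Π` "cuts out the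
parabolic cohomology"; here only its action is defined). [cite: DeningerScholl1991, 5.3 (i)] -/
def schollProjectorBetti [NeZero N] [IsCommMonObj V.curve.E] (i : ℕ) :
    bettiCohomology V.W i →ₗ[ℚ] bettiCohomology V.W i :=
  V.bettiAction i V.schollProjector

/-- `Π_ε` acts as an idempotent on `Hⁱ_B(W)`. [cite: DeningerScholl1991, 5.3 (i)] -/
theorem isIdempotentElem_schollProjectorBetti [NeZero N] [IsCommMonObj V.curve.E] (i : ℕ) :
    IsIdempotentElem (V.schollProjectorBetti i) :=
  V.isIdempotentElem_schollProjector.map (V.bettiAction i)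

/-- `Π_ε ∘ Π_ε = Π_ε` on `Hⁱ_B(W)`. [cite: DeningerScholl1991, 5.3 (i)] -/
theorem schollProjectorBetti_comp_self [NeZero N] [IsCommMonObj V.curve.E] (i : ℕ) :
    V.schollProjectorBetti i ∘ₗ V.schollProjectorBetti i = V.schollProjectorBetti i :=
  (V.isIdempotentElem_schollProjectorBetti i).eq

/-- `Π_ε (Π_ε x) = Π_ε x`. [cite: DeningerScholl1991, 5.3 (i)] -/
theorem schollProjectorBetti_apply_apply [NeZero N] [IsCommMonObj V.curve.E] (i : ℕ)
    (x : bettiCohomology V.W i) :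
    V.schollProjectorBetti i (V.schollProjectorBetti i x) = V.schollProjectorBetti i x :=
  LinearMap.congr_fun (V.schollProjectorBetti_comp_self i) x

/-- **The `ε`-part `Π_ε Hⁱ_B(W)`** of the Betti cohomology of `W` (for `i = m + 1` and
Deligne's model this is the parabolic cohomology, Deninger–Scholl 5.3 (i), 5.2 Remark (2);
that identification is not made here). [cite: DeningerScholl1991, 5.3 (i)] -/
def schollPart [NeZero N] [IsCommMonObj V.curve.E] (i : ℕ) : Submodule ℚ (bettiCohomology V.W i) :=
  LinearMap.range (V.schollProjectorBetti i)

/-- `Π_ε x ∈ Π_ε Hⁱ_B(W)`. [folklore] -/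
theorem schollProjectorBetti_mem_schollPart [NeZero N] [IsCommMonObj V.curve.E] (i : ℕ)
    (x : bettiCohomology V.W i) : V.schollProjectorBetti i x ∈ V.schollPart i :=
  LinearMap.mem_range_self _ x

/-- `x ∈ Π_ε Hⁱ_B(W) ↔ Π_ε x = x` (`Π_ε` is idempotent). [folklore] -/
theorem mem_schollPart_iff [NeZero N] [IsCommMonObj V.curve.E] (i : ℕ)
    (x : bettiCohomology V.W i) : x ∈ V.schollPart i ↔ V.schollProjectorBetti i x = x := by
  constructor
  · intro hx
    obtain ⟨y, rfl⟩ := LinearMap.mem_range.mp hx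
    exact V.schollProjectorBetti_apply_apply i y
  · intro hx
    exact LinearMap.mem_range.mpr ⟨x, hx⟩

/-! ### How the generators act on the `ε`-part -/

/-- **Translations act trivially on the `ε`-part**: `(translW j u)* ∘ Π_ε = Π_ε`.
[cite: DeningerScholl1991, 5.3 (i)] -/
theorem map_translW_comp_schollProjectorBetti [NeZero N] [IsCommMonObj V.curve.E] (i : ℕ)
    (j : Fin m) (u : ZMod N × ZMod N) :
    (bettiCohomology.map (V.translW j u).hom i).hom ∘ₗ V.schollProjectorBetti i =
      V.schollProjectorBetti i := by
  rw [show (V.translW j u).hom = (V.translA j u).hom from rfl, map_hom_eq_bettiAction,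
    schollProjectorBetti, ← Module.End.mul_eq_comp, ← map_mul, ← V.translA_neg_eq_inv j u,
    of_translA_mul_schollProjector]

/-- **Inversions act by `-1` on the `ε`-part**: `(negW j)* ∘ Π_ε = -Π_ε`.
[cite: DeningerScholl1991, 5.3 (i)] -/
theorem map_negW_comp_schollProjectorBetti [NeZero N] [IsCommMonObj V.curve.E] (i : ℕ)
    (j : Fin m) :
    (bettiCohomology.map (V.negW j).hom i).hom ∘ₗ V.schollProjectorBetti i =
      -V.schollProjectorBetti i := by
  rw [show (V.negW j).hom = (V.negA j).hom from rfl, map_hom_eq_bettiAction, schollProjectorBetti,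
    ← Module.End.mul_eq_comp, ← map_mul, negA_inv, of_negA_mul_schollProjector, map_neg]

/-- **Permutations act through the sign on the `ε`-part**: `(permW σ)* ∘ Π_ε = sgn(σ) Π_ε`.
[cite: DeningerScholl1991, 5.3 (i)] -/
theorem map_permW_comp_schollProjectorBetti [NeZero N] [IsCommMonObj V.curve.E] (i : ℕ)
    (σ : Equiv.Perm (Fin m)) :
    (bettiCohomology.map (V.permW σ).hom i).hom ∘ₗ V.schollProjectorBetti i =
      permSign m σ • V.schollProjectorBetti i := by
  rw [show (V.permW σ).hom = (V.permA σ).hom from rfl, map_hom_eq_bettiAction, schollProjectorBetti,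
    ← Module.End.mul_eq_comp, ← map_mul, show (V.permA σ)⁻¹ = V.permA σ⁻¹ from
      (map_inv V.permHom σ).symm, of_permA_mul_schollProjector, map_smul, permSign_inv]

/-- On `x ∈ Π_ε Hⁱ_B(W)`: `(translW j u)* x = x`. [cite: DeningerScholl1991, 5.3 (i)] -/
theorem map_translW_of_mem_schollPart [NeZero N] [IsCommMonObj V.curve.E] {i : ℕ}
    {x : bettiCohomology V.W i} (hx : x ∈ V.schollPart i) (j : Fin m) (u : ZMod N × ZMod N) :
    bettiCohomology.map (V.translW j u).hom i x = x := by
  obtain ⟨y, rfl⟩ := LinearMap.mem_range.mp hx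
  exact LinearMap.congr_fun (V.map_translW_comp_schollProjectorBetti i j u) y

/-- On `x ∈ Π_ε Hⁱ_B(W)`: `(negW j)* x = -x`. [cite: DeningerScholl1991, 5.3 (i)] -/
theorem map_negW_of_mem_schollPart [NeZero N] [IsCommMonObj V.curve.E] {i : ℕ}
    {x : bettiCohomology V.W i} (hx : x ∈ V.schollPart i) (j : Fin m) :
    bettiCohomology.map (V.negW j).hom i x = -x := by
  obtain ⟨y, rfl⟩ := LinearMap.mem_range.mp hx
  exact LinearMap.congr_fun (V.map_negW_comp_schollProjectorBetti i j) y

/-- On `x ∈ Π_ε Hⁱ_B(W)`: `(permW σ)* x = sgn(σ) x`. [cite: DeningerScholl1991, 5.3 (i)] -/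
theorem map_permW_of_mem_schollPart [NeZero N] [IsCommMonObj V.curve.E] {i : ℕ}
    {x : bettiCohomology V.W i} (hx : x ∈ V.schollPart i) (σ : Equiv.Perm (Fin m)) :
    bettiCohomology.map (V.permW σ).hom i x = permSign m σ • x := by
  obtain ⟨y, rfl⟩ := LinearMap.mem_range.mp hx
  exact LinearMap.congr_fun (V.map_permW_comp_schollProjectorBetti i σ) y

/-- **`Π_ε Hⁱ_B(W)` is the joint `ε`-eigenspace**: `x ∈ Π_ε Hⁱ_B(W)` iff every translation
`t ∈ ((ℤ/N)²)^m` fixes `x`, every `s ∈ (ℤ/2)^m` acts on `x` by `∏ᵢ (-1)^{sᵢ}` and every `σ ∈ S_m`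
by `sgn(σ)` (actions through `bettiAction [g] = (g⁻¹)*`; for these three subgroups `g ↦ g⁻¹` is a
bijection preserving the character, so the same conditions hold for the pull-backs `g*`).
(Deninger–Scholl 5.3 (i).) [cite: DeningerScholl1991, 5.3 (i)] -/
theorem mem_schollPart_iff_forall [NeZero N] [IsCommMonObj V.curve.E] (i : ℕ)
    (x : bettiCohomology V.W i) :
    x ∈ V.schollPart i ↔
      (∀ t : Fin m → Multiplicative (ZMod N × ZMod N),
          V.bettiAction i (MonoidAlgebra.of ℚ _ (V.translPiHom t)) x = x) ∧
        (∀ s : Fin m → Multiplicative (ZMod 2),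
          V.bettiAction i (MonoidAlgebra.of ℚ _ (V.negPiHom s)) x = negPiSign m s • x) ∧
        ∀ σ : Equiv.Perm (Fin m),
          V.bettiAction i (MonoidAlgebra.of ℚ _ (V.permA σ)) x = permSign m σ • x := by
  constructor
  · intro hx
    obtain ⟨y, rfl⟩ := LinearMap.mem_range.mp hx
    refine ⟨fun t => ?_, fun s => ?_, fun σ => ?_⟩
    · rw [schollProjectorBetti, ← Module.End.mul_apply, ← map_mul,
        of_translPiHom_mul_schollProjector]
    · rw [schollProjectorBetti, ← Module.End.mul_apply, ← map_mul,
        of_negPiHom_mul_schollProjector, map_smul, LinearMap.smul_apply]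
    · rw [schollProjectorBetti, ← Module.End.mul_apply, ← map_mul, of_permA_mul_schollProjector,
        map_smul, LinearMap.smul_apply]
  · rintro ⟨hT, hM, hS⟩
    rw [mem_schollPart_iff, schollProjectorBetti, schollProjector, map_mul, map_mul,
      Module.End.mul_apply, Module.End.mul_apply]
    have eS : V.bettiAction i V.permProjector x = x :=
      characterProjector_apply_eq_self _ _ _ fun σ => by
        rw [permHom_apply, hS, permSign_inv]
    have eM : V.bettiAction i V.negProjector x = x :=
      characterProjector_apply_eq_self _ _ _ fun s => by rw [hM, negPi_inv_eq_self]
    have eT : V.bettiAction i V.translProjector x = x :=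
      characterProjector_apply_eq_self _ _ _ fun t => by rw [hT, MonoidHom.one_apply, one_smul]
    rw [eS, eM, eT]

end KugaSatoVariety

end Literature.NumberTheory.EllipticCurves

end
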